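import Summits.AtomisticToContinuum.FouriersLaw.Theses.HoelderEscapeProfile

/-!
# `FibreCalculus` (stmt-AtomisticToContinuum-16011): the DLR–Gibbs guard is load-bearing

Negative lemma (refuter, crux-attack load-bearing analysis) for the crux
`Summit.AtomisticToContinuum.FouriersLaw.Theses.HoelderEscapeProfile.FibreCalculus` (route
`HoelderEscapeProfile`, sub-problem `FouriersLaw`). The crux quantifies over every GUARDED arena
`(μ, D)`: `μ` a DLR Gibbs state of `pinnedChain ω₂ lam β γ` at temperature `T`, shift- and
momentum-reversal-invariant; `D` an `InfiniteChainDynamics` preserving `μ` whose flow commutes with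
the shift `μ`-a.e. We show that the ONE hypothesis `IsChainGibbsMeasure T μ` cannot be weakened to
"`μ` is a (shift- and reversal-invariant) probability measure": the FROZEN junk arena —
`μ = δ_0` (Dirac mass at the equilibrium configuration `q = p = 0`) with the frozen dynamics
(carrier `{0}`, `φ_t = id`, an admissible `InfiniteChainDynamics` of every pinned chain because
`U'(0) = 0`, cf. `OscillatorChain.isSolution_const_zero`) — satisfies every other guard verbatim
(`δ_0` is shift- and reversal-invariant, `id` preserves it and commutes with the shift, `δ_0` is
carried by `{0}`), and there clause (6) `0 < χ(0) = Σ_x Cov(h_0, h_x)` of the conclusion fails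
(`S ≡ 0`). So any proof of `FibreCalculus` must use the DLR equations of `μ` — they (and only
they, among the guards) exclude the frozen dynamics: `PreservesMeasure.1` forces
`μ(carrier) = 1`, and `δ_0` is not a Gibbs state (its one-site conditional law is not Lebesgue-
absolutely continuous). No statement of the route is asserted here.
-/

noncomputable section

open MeasureTheory Filter Set

namespace Summit.AtomisticToContinuum.FouriersLaw.Theorems.FibreCalculus.Negative

open Literature.MathematicalPhysics.KineticTheory.HeatConduction

/-- **`FibreCalculus` is false without the Gibbs (DLR) hypothesis.** The displayed statement is
`HoelderEscapeProfile.FibreCalculus` VERBATIM except that the guard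
`(pinnedChain ω₂ lam β γ).IsChainGibbsMeasure T μ` is replaced by `IsProbabilityMeasure μ`; it is
refuted by the frozen arena `(δ_0, φ_t = id on the carrier {0})` at `ω₂ = lam = β = T = 1`,
`γ = 0`, where `χ(0) = ∑_x S(x,0) = 0` contradicts clause (6) `0 < χ(0)`. [folklore] -/
theorem fibreCalculus_false_without_isChainGibbsMeasure :
    ¬ (∀ ω₂ lam β γ : ℝ, 0 < ω₂ → 0 < lam → 0 < β → ∀ T : ℝ, 0 < T → ∀ μ : MeasureTheory.Measure Literature.MathematicalPhysics.KineticTheory.HeatConduction.ChainConfig, MeasureTheory.IsProbabilityMeasure μ → Literature.MathematicalPhysics.KineticTheory.HeatConduction.IsShiftInvariant μ → μ.map (fun σ : Literature.MathematicalPhysics.KineticTheory.HeatConduction.ChainConfig => fun x : ℤ => ((σ x).1, -(σ x).2)) = μ → ∀ D : Literature.MathematicalPhysics.KineticTheory.HeatConduction.InfiniteChainDynamics (Literature.MathematicalPhysics.KineticTheory.HeatConduction.pinnedChain ω₂ lam β γ), D.PreservesMeasure μ → (∀ t : ℝ, ∀ᵐ σ ∂μ, D.flow t (Literature.MathematicalPhysics.KineticTheory.HeatConduction.shift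 σ) = Literature.MathematicalPhysics.KineticTheory.HeatConduction.shift (D.flow t σ)) → ∀ h : Literature.MathematicalPhysics.KineticTheory.HeatConduction.ChainConfig → ℤ → ℝ, h = (fun (σ : Literature.MathematicalPhysics.KineticTheory.HeatConduction.ChainConfig) (x : ℤ) => (σ x).2 ^ 2 / 2 + (Literature.MathematicalPhysics.KineticTheory.HeatConduction.pinnedChain ω₂ lam β γ).U (σ x).1 + ((Literature.MathematicalPhysics.KineticTheory.HeatConduction.pinnedChain ω₂ lam β γ).V ((σ (x + 1)).1 - (σ x).1) + (Literature.MathematicalPhysics.KineticTheory.HeatConduction.pinnedChain ω₂ lam β γ).V ((σ x).1 - (σ (x - 1)).1)) / 2) → ∀ S : ℤ → ℝ → ℝ, S = (fun (x : ℤ) (t : ℝ) => ∫ σ, (h σ 0 - ∫ σ', h σ' 0 ∂μ) * (h (D.flow t σ) x - ∫ σ', h σ' 0 ∂μ) ∂μ) → ∀ Sb : ℝ → ℤ → ℝ, Sb = (fun (ν : ℝ) (x : ℤ) => ν * ∫ t in Set.Ioi (0:ℝ), Real.exp (-(ν * t)) * S x t) → ∀ G : ℤ → ℝ → ℝ, G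 = (fun (x : ℤ) (t : ℝ) => ∫ σ, (Literature.MathematicalPhysics.KineticTheory.HeatConduction.pinnedChain ω₂ lam β γ).bondCurrentZ σ 0 * (Literature.MathematicalPhysics.KineticTheory.HeatConduction.pinnedChain ω₂ lam β γ).bondCurrentZ (D.flow t σ) x ∂μ) → ∀ Gh : ℝ → ℝ → ℝ, Gh = (fun (ν k : ℝ) => ∫ t in Set.Ioi (0:ℝ), Real.exp (-(ν * t)) * ∑' x : ℤ, Real.cos (k * (x : ℝ)) * G x t) → ∀ fh : ℝ → ℝ → ℝ, fh = (fun (ν k : ℝ) => ∑' x : ℤ, Real.cos (k * (x : ℝ)) * Sb ν x) → ∀ χk : ℝ → ℝ, χk = (fun k : ℝ => ∑' x : ℤ, Real.cos (k * (x : ℝ)) * S x 0) → (∀ t : ℝ, D.HasAbsConvergentCorrelation μ t) ∧ (∀ ν : ℝ, 0 < ν → MeasureTheory.IntegrableOn (fun t : ℝ => Real.exp (-(ν * t)) * D.currentCorrelation μ t) (Set.Ioi 0)) ∧ (∀ x : ℤ, ∀ ν : ℝ, 0 < ν → MeasureTheory.IntegrableOn (fun t : ℝ => Real.exp (-(ν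 * t)) * S x t) (Set.Ioi 0)) ∧ (∀ ν : ℝ, 0 < ν → Summable (fun x : ℤ => (1 + (x : ℝ) ^ 2) * |Sb ν x|)) ∧ Summable (fun x : ℤ => (1 + (x : ℝ) ^ 2) * |S x 0|) ∧ 0 < χk 0 ∧ (∀ ν : ℝ, 0 < ν → ∑' x : ℤ, Sb ν x = χk 0) ∧ (∀ ν : ℝ, 0 < ν → ∀ k : ℝ, 0 ≤ fh ν k) ∧ (∀ ν : ℝ, 0 < ν → ∫ k in (-Real.pi)..Real.pi, fh ν k = 2 * Real.pi * Sb ν 0) ∧ (∀ ν : ℝ, 0 < ν → ∀ k : ℝ, MeasureTheory.IntegrableOn (fun t : ℝ => Real.exp (-(ν * t)) * ∑' x : ℤ, Real.cos (k * (x : ℝ)) * G x t) (Set.Ioi 0)) ∧ (∀ ν : ℝ, 0 < ν → ∀ k : ℝ, χk k - fh ν k = (2 - 2 * Real.cos k) * Gh ν k / ν) ∧ (∀ ν : ℝ, 0 < ν → ∫ t in Set.Ioi (0:ℝ), Real.exp (-(ν * t)) * D.currentCorrelation μ t = ν / 2 * ((∑' x : ℤ, (x : ℝ) ^ 2 * Sb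 ν x) - ∑' x : ℤ, (x : ℝ) ^ 2 * S x 0))) := by
  intro H
  -- the pinned chain at ω₂ = lam = β = 1, γ = 0, and its equilibrium `0`
  have hU0 : deriv (pinnedChain 1 1 1 0).U 0 = 0 := by
    have h1 : HasDerivAt (fun q : ℝ => 1 * q ^ 2 / 2 + 1 * q ^ 4 / 4)
        (1 * (↑(2 : ℕ) * (0 : ℝ) ^ (2 - 1)) / 2 + 1 * (↑(4 : ℕ) * (0 : ℝ) ^ (4 - 1)) / 4) 0 :=
      (((hasDerivAt_pow 2 (0 : ℝ)).const_mul 1).div_const 2).add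
        (((hasDerivAt_pow 4 (0 : ℝ)).const_mul 1).div_const 4)
    show deriv (fun q : ℝ => 1 * q ^ 2 / 2 + 1 * q ^ 4 / 4) 0 = 0
    rw [h1.deriv]
    norm_num
  -- the FROZEN dynamics: carrier `{0}`, flow `id`
  let D : InfiniteChainDynamics (pinnedChain 1 1 1 0) :=
    { carrier := {0}
      flow := fun _ σ => σ
      mapsTo := fun _ σ hσ => hσ
      flow_zero := fun _ _ => rfl
      isSolution := by
        intro σ hσ
        rw [Set.mem_singleton_iff] at hσ
        subst hσ
        exact (pinnedChain 1 1 1 0).isSolution_const_zero hU0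
      unique := by
        intro c hc _ t
        have h1 : c t = 0 := hc t
        have h0 : c 0 = 0 := hc 0
        show c t = c 0
        rw [h1, h0] }
  -- the Dirac mass at `0` satisfies every guard except the DLR equations
  have hshift : Measurable (shift : ChainConfig → ChainConfig) :=
    measurable_pi_lambda _ fun x => measurable_pi_apply (x + 1)
  have hrev : Measurable (fun σ : ChainConfig => fun x : ℤ => ((σ x).1, -(σ x).2)) :=
    measurable_pi_lambda _ fun x =>
      (measurable_pi_apply x).fst.prodMk (measurable_pi_apply x).snd.neg
  have hSI : IsShiftInvariant (Measure.dirac (0 : ChainConfig)) := by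
    unfold IsShiftInvariant
    rw [Measure.map_dirac' hshift]
    rfl
  have hR : (Measure.dirac (0 : ChainConfig)).map
      (fun σ : ChainConfig => fun x : ℤ => ((σ x).1, -(σ x).2)) = Measure.dirac 0 := by
    rw [Measure.map_dirac' hrev]
    congr 1
    funext x
    simp only [Pi.zero_apply, Prod.fst_zero, Prod.snd_zero, neg_zero, Prod.mk_zero_zero]
  have hP : D.PreservesMeasure (Measure.dirac (0 : ChainConfig)) := by
    refine ⟨?_, fun t => MeasurePreserving.id _⟩
    rw [ae_dirac_eq, eventually_pure]
    exact Set.mem_singleton 0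
  have hC : ∀ t : ℝ, ∀ᵐ σ ∂(Measure.dirac (0 : ChainConfig)),
      D.flow t (shift σ) = shift (D.flow t σ) :=
    fun t => Eventually.of_forall fun σ => rfl
  -- instantiate the statement at the frozen arena and read off clause (6)
  obtain ⟨-, -, -, -, -, h6, -⟩ :=
    H 1 1 1 0 one_pos one_pos one_pos 1 one_pos (Measure.dirac 0) inferInstance hSI hR D hP hC
      _ rfl _ rfl _ rfl _ rfl _ rfl _ rfl _ rfl
  simp only [integral_dirac, sub_self, zero_mul, mul_zero, tsum_zero, lt_self_iff_false] at h6

end Summit.AtomisticToContinuum.FouriersLaw.Theorems.FibreCalculus.Negative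

end
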